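import Mathlib
import HarnessLib
import Summits.HubbardSuperconductivity.HubbardSuperconductivity.Theorems.KLProgrammeKLRegimeVolumeLimitTwoPointHamiltonianCut
import Summits.HubbardSuperconductivity.HubbardSuperconductivity.Theorems.KLProgrammeKLRegimeVolumeLimitCutoffRemoval

/-!
# Under (H1): the label-uniform cutoff limit of the bare VL carrier holds towards the HAMILTONIAN proxy, and k3c5-p3's cutoff-free
# carrier `klSelfEnergyInf … 0 n p` IS the re-amputated Hamiltonian self-energy (seat hubbard-kl-k3c5-p2, g3)

Route `KLProgramme`, child VOLUME-LIMIT (gen 5: stmt-HubbardSuperconductivity-19921 `KLRegimeVolumeLimitV14`; gen 4: 19858), stub `stub_vl_twoVolumeRate`.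
k3c5-p3's `klSelfEnergy_cutoffLimit_labelUniform` (`…VolumeLimitCutoffRemoval`) is the `hcut` input of k3c4-p1's Cauchy doors with the Grassmann-side
proxy `klSelfEnergyInf L β U μ K n p = (g₀/g_K)²(U·occ∞ + U²·Six∞_L(n,p)) + (g_K − g₀)/g_K²`.  With `hcut_hamiltonian_of_H1` (`…TwoPointHamiltonianCut`):

* **`hcut_hamiltonian`** — under (H1) at `L ≥ 3` (every `U`, `β > 0`), for every `ε > 0` there is `M₁` with, for all `M ≥ M₁`, ALL kept labels `ω`,
  momenta `k` and spins `σ`: `‖klSelfEnergy L M β U μ 0 klE0 (nScales β + 1) (ω, k) σ − (1/D_k − 𝒢_{H'}(k₀(n_ω), −k))·D_k²‖ ≤ ε` — the `hcut` of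
  `stub_vl_twoVolumeRate_of_bareSplit[_V14]` with the Hamiltonian proxy, OUTRIGHT;
* **`klSelfEnergyInf_zero_eq_reamputated`** — under (H1): `klSelfEnergyInf L β U μ 0 n p = (1/D_p − 𝒢_{H'}(k₀(n), −p))·D_p²` for every `n, p`
  (uniqueness of per-label limits) — the word six-point limit object `Six∞_L` is thereby expressed through TWO-point Hamiltonian data:
  `U·occ∞ + U²·Six∞_L(n,p) = Σ_H(L; n, p)`.

So after (H1) the VL child's remaining debt `hvol` reads: a two-volume rate with momentum modulus for the re-amputated Matsubara Green function of the
finite torus `hubbardTorusWith 2 L 1 U (μ + U/2)` — no Grassmann object, no Matsubara cutoff.  Everything is proved; no definition.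
-/

noncomputable section

namespace Summit.HubbardSuperconductivity.HubbardSuperconductivity.Theorems.TwoPointAssembly

set_option linter.dupNamespace false -- summit = problem name (single-conjunct summit), D-0017

open Finset Filter Topology MeasureTheory intervalIntegral Complex Literature.MathematicalPhysics.QuantumLattice Literature.Probability.LatticeModels
  GrassmannAlgebra
open Summit.HubbardSuperconductivity.HubbardSuperconductivity.Theorems.ThermalGreen
open Summit.HubbardSuperconductivity.HubbardSuperconductivity.Theorems.MatsubaraAllU
open Summit.HubbardSuperconductivity.HubbardSuperconductivity.Theorems.KLRegimeSplit
open Summit.HubbardSuperconductivity.HubbardSuperconductivity.Theorems.KLProgrammeLegKernels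
open scoped ComplexConjugate

variable {L : ℕ} [NeZero L]

/-- **`hcut` TOWARDS THE HAMILTONIAN PROXY, OUTRIGHT** (under (H1) at `L ≥ 3`; every `U`, `β > 0`; k3c5-p3's label-uniform cutoff removal supplies
the label-uniformity, `hcut_hamiltonian_of_H1` swaps the proxy). -/
theorem hcut_hamiltonian (hL : 3 ≤ L) {β : ℝ} (hβ : 0 < β) (U μ : ℝ)
    (hH1 : ∀ (x y : TorusSite 2 L), ∀ s ∈ Set.Ioo (0 : ℝ) β,
      Tendsto (fun M : ℕ => gaussExpect ℂ (hubbardCovariance L M β μ 0)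
          (positionField L M β 0 0 x s * positionField L M β 1 0 y 0 * grassmannExp (-(hubbardInteraction L M β U)))) atTop
        (𝓝 ((Real.exp (-(β * U / 4 * (L : ℝ) ^ 2)) : ℂ) *
          (Matrix.gibbsWeight (β - s) (hubbardTorusWith 2 L 1 U (μ + U / 2)) * creation (orb (FermionTorus.ofTorusSite x) 0) *
            (Matrix.gibbsWeight s (hubbardTorusWith 2 L 1 U (μ + U / 2)) * annihilation (orb (FermionTorus.ofTorusSite y) 0))).trace /
          Matrix.partitionFn β (hubbardTorusWith 2 L 1 0 μ)))) :
    ∀ ε : ℝ, 0 < ε → ∃ M₁ : ℕ, ∀ (M : ℕ) [NeZero M], M₁ ≤ M → ∀ (ω : MatsubaraIdx M) (k : TorusSite 2 L) (σ : Fin 2),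
      ‖klSelfEnergy L M β U μ 0 klE0 (nScales β + 1) (ω, k) σ -
          (1 / (-Complex.I * ((Real.pi * (2 * ((matsubaraInt M ω : ℤ) : ℝ) + 1) / β : ℝ) : ℂ) + (nambuXiCT L μ 0 k : ℂ)) -
              ∫ τ in (0 : ℝ)..β, cexp (I * ((Real.pi * (2 * ((matsubaraInt M ω : ℤ) : ℝ) + 1) / β : ℝ) : ℂ) * τ) *
                Matrix.gibbsState β (hubbardTorusWith 2 L 1 U (μ + U / 2))
                  (Matrix.imagTimeEvolve (hubbardTorusWith 2 L 1 U (μ + U / 2)) (τ : ℂ) (momentumAnnihilation (-k) 0) *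
                    momentumCreation (-k) 0)) *
            (-Complex.I * ((Real.pi * (2 * ((matsubaraInt M ω : ℤ) : ℝ) + 1) / β : ℝ) : ℂ) + (nambuXiCT L μ 0 k : ℂ)) ^ 2‖ ≤ ε :=
  hcut_hamiltonian_of_H1 hL hβ U μ hH1 (fun n k _ => klSelfEnergyInf L β U μ 0 n k)
    fun _ hε => klSelfEnergy_cutoffLimit_labelUniform hL hβ U μ 0 hε

/-- **k3c5-p3's CUTOFF-FREE BARE CARRIER IS THE RE-AMPUTATED HAMILTONIAN SELF-ENERGY** (under (H1) at `L ≥ 3`; every `U`, `β > 0`): for every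
Matsubara integer `n` and torus momentum `p`, `klSelfEnergyInf L β U μ 0 n p = (1/D_p − 𝒢_{H'}(k₀(n), −p))·D_p²` — i.e.
`U·occ∞(L) + U²·Six∞_L(n,p) = Σ_H(L; n, p)` (uniqueness of the per-label limit of `Σ̂⁰_{L,M}((ω_n,p),↑)`). -/
theorem klSelfEnergyInf_zero_eq_reamputated (hL : 3 ≤ L) {β : ℝ} (hβ : 0 < β) (U μ : ℝ)
    (hH1 : ∀ (x y : TorusSite 2 L), ∀ s ∈ Set.Ioo (0 : ℝ) β,
      Tendsto (fun M : ℕ => gaussExpect ℂ (hubbardCovariance L M β μ 0)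
          (positionField L M β 0 0 x s * positionField L M β 1 0 y 0 * grassmannExp (-(hubbardInteraction L M β U)))) atTop
        (𝓝 ((Real.exp (-(β * U / 4 * (L : ℝ) ^ 2)) : ℂ) *
          (Matrix.gibbsWeight (β - s) (hubbardTorusWith 2 L 1 U (μ + U / 2)) * creation (orb (FermionTorus.ofTorusSite x) 0) *
            (Matrix.gibbsWeight s (hubbardTorusWith 2 L 1 U (μ + U / 2)) * annihilation (orb (FermionTorus.ofTorusSite y) 0))).trace /
          Matrix.partitionFn β (hubbardTorusWith 2 L 1 0 μ))))
    (n : ℤ) (p : TorusSite 2 L) :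
    klSelfEnergyInf L β U μ 0 n p =
      (1 / (-Complex.I * ((Real.pi * (2 * (n : ℝ) + 1) / β : ℝ) : ℂ) + (nambuXiCT L μ 0 p : ℂ)) -
          ∫ τ in (0 : ℝ)..β, cexp (I * ((Real.pi * (2 * (n : ℝ) + 1) / β : ℝ) : ℂ) * τ) *
            Matrix.gibbsState β (hubbardTorusWith 2 L 1 U (μ + U / 2))
              (Matrix.imagTimeEvolve (hubbardTorusWith 2 L 1 U (μ + U / 2)) (τ : ℂ) (momentumAnnihilation (-p) 0) *
                momentumCreation (-p) 0)) *
        (-Complex.I * ((Real.pi * (2 * (n : ℝ) + 1) / β : ℝ) : ℂ) + (nambuXiCT L μ 0 p : ℂ)) ^ 2 := by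
  refine labelLimit_unique (F := fun M ω => klSelfEnergy L M β U μ 0 klE0 (nScales β + 1) (ω, p) 0) (n := n) ?_
    (klSelfEnergy_bare_label_limit_eq_reamputated hL hβ U μ hH1 n p)
  intro ε hε
  obtain ⟨M₁, hM₁⟩ := klSelfEnergy_cutoffLimit_labelUniform hL hβ U μ 0 hε
  refine ⟨M₁ + 1, fun M hM ω hω => ?_⟩
  haveI : NeZero M := ⟨by omega⟩
  have h := hM₁ M (by omega) ω p 0
  rwa [hω] at h

/-- **Every frame**: under (H1), k3c5-p3's cutoff-free carrier in the frame `K` is the frame-dressed re-amputated Hamiltonian self-energy,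
`Σ∞^K_L(n,p) = (g₀/g_K)²·(1/D_p − 𝒢_{H'}(k₀,−p))·D_p² + (g_K − g₀)/g_K²` (`klSelfEnergyInf_eq_dressing` + `klSelfEnergyInf_zero_eq_reamputated`). -/
theorem klSelfEnergyInf_eq_reamputated_frame (hL : 3 ≤ L) {β : ℝ} (hβ : 0 < β) (U μ : ℝ)
    (hH1 : ∀ (x y : TorusSite 2 L), ∀ s ∈ Set.Ioo (0 : ℝ) β,
      Tendsto (fun M : ℕ => gaussExpect ℂ (hubbardCovariance L M β μ 0)
          (positionField L M β 0 0 x s * positionField L M β 1 0 y 0 * grassmannExp (-(hubbardInteraction L M β U)))) atTop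
        (𝓝 ((Real.exp (-(β * U / 4 * (L : ℝ) ^ 2)) : ℂ) *
          (Matrix.gibbsWeight (β - s) (hubbardTorusWith 2 L 1 U (μ + U / 2)) * creation (orb (FermionTorus.ofTorusSite x) 0) *
            (Matrix.gibbsWeight s (hubbardTorusWith 2 L 1 U (μ + U / 2)) * annihilation (orb (FermionTorus.ofTorusSite y) 0))).trace /
          Matrix.partitionFn β (hubbardTorusWith 2 L 1 0 μ))))
    (K : TrigPolyC4v) (n : ℤ) (p : TorusSite 2 L) :
    klSelfEnergyInf L β U μ K n p =
      (propInt β μ 0 n (latticeMomentum L p) / propInt β μ K n (latticeMomentum L p)) ^ 2 *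
          ((1 / (-Complex.I * ((Real.pi * (2 * (n : ℝ) + 1) / β : ℝ) : ℂ) + (nambuXiCT L μ 0 p : ℂ)) -
              ∫ τ in (0 : ℝ)..β, cexp (I * ((Real.pi * (2 * (n : ℝ) + 1) / β : ℝ) : ℂ) * τ) *
                Matrix.gibbsState β (hubbardTorusWith 2 L 1 U (μ + U / 2))
                  (Matrix.imagTimeEvolve (hubbardTorusWith 2 L 1 U (μ + U / 2)) (τ : ℂ) (momentumAnnihilation (-p) 0) *
                    momentumCreation (-p) 0)) *
            (-Complex.I * ((Real.pi * (2 * (n : ℝ) + 1) / β : ℝ) : ℂ) + (nambuXiCT L μ 0 p : ℂ)) ^ 2) +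
        (propInt β μ K n (latticeMomentum L p) - propInt β μ 0 n (latticeMomentum L p)) / propInt β μ K n (latticeMomentum L p) ^ 2 := by
  rw [klSelfEnergyInf_eq_dressing hβ.ne', klSelfEnergyInf_zero_eq_reamputated hL hβ U μ hH1 n p]

end Summit.HubbardSuperconductivity.HubbardSuperconductivity.Theorems.TwoPointAssembly

end
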